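import Summits.Ventures.AbcSig.Sieve.CertificateModN

/-!
# Venture AbcSig — FACTORED mod-`n` certificates: split `F` modulo `n` first, then one small tree per factor

HONEST FRAMING. Certificate checker of a COMPUTATION cell (`pub-abcsig`); no Diophantine statement, no claim on ABC or any
summit. `Sieve/CertificateModN.lean` certifies `o.Eliminated A n` by ONE tree whose Bézout leaves live in `(ℤ/n)[x]/(F)` —
for Hecke fields of degree `≈ 50` the leaf cofactors are degree-`49` integer lists and the tree literal itself exceeds the
default elaboration budget (p-lean g7, 2026-08-23: module-M4 class discharges of degree-54 orbits needed their leaves split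
into separate definitions and ≈ 20 KB per certificate). THIS FILE proves the obvious improvement: a ring homomorphism
`φ : ℤ[X] → k` into a FIELD of characteristic `n` with `φ(F) = 0` kills SOME factor of any factorisation
`F ≡ G₁·G₂·…·G_r (mod n)` (a field has no zero divisors), so it suffices to give, for EACH factor `Gᵢ`, a mod-`n` tree run
from the generator list `[Gᵢ]` — whose leaves have degree `< deg Gᵢ`. With the `Gᵢ` the irreducible factors of `F mod n`
(or any factorisation found outside Lean; irreducibility is NOT needed for soundness) the certificates are tiny.

* `prodL` (product of coefficient lists, `toPoly_prodL`),
* `factoredCheckN n fuel o A Gs Ts` (Boolean): all coefficients of `∏ Gs − F` divisible by `n`, one tree per factor, and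
  `(Ts[i]).check n fuel o A [Gs[i]] = true` for every `i`,
* `OrbitData.eliminated_of_factoredCheckN` (soundness): the check implies `o.Eliminated A n`.

Reference: [BS04] Bennett–Skinner, Canad. J. Math. 56 (2004), Prop. 4.3 (congruences modulo a prime above `n`); the
factorisation step is the standard "primes above `n` ↔ irreducible factors of `F mod n`" bookkeeping (no Dedekind–Kummer
hypothesis is used: the argument is only that a field has no zero divisors).
-/

namespace Summit.Ventures.AbcSig

open Polynomial

/-- Product of a list of little-endian coefficient lists. -/
def prodL : List (List ℤ) → List ℤ
  | [] => [1]
  | G :: Gs => mulL G (prodL Gs)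

/-- `toPoly (prodL Gs) = ∏ toPoly Gᵢ`. -/
lemma toPoly_prodL : ∀ Gs : List (List ℤ), toPoly (prodL Gs) = (Gs.map toPoly).prod
  | [] => by simp [prodL]
  | G :: Gs => by rw [prodL, toPoly_mulL, toPoly_prodL Gs, List.map_cons, List.prod_cons]

/-- **The factored check** (computable, `decide`): `∏ Gs ≡ F (mod n)` coefficientwise, as many trees as factors, and the
`i`-th tree passes the mod-`n` check of `Sieve/CertificateModN.lean` from the generator list `[Gs[i]]`. -/
def factoredCheckN (n fuel : ℕ) (o : OrbitData) (A : ℕ → List ℤ) (Gs : List (List ℤ)) (Ts : List TreeN) : Bool :=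
  isZeroModL n (addL (prodL Gs) (smulL (-1) o.F)) && (Gs.length == Ts.length) &&
    (Gs.zip Ts).all fun GT => GT.2.check n fuel o A [GT.1]

/-- **Soundness.** If `factoredCheckN n fuel o A Gs Ts = true` then `o.Eliminated A n`: a realisation `φ` (field `k` of
characteristic `n`, `φ(F) = 0`, allowed traces at the listed primes `≠ n`) has `∏ φ(Gᵢ) = φ(F) = 0`, hence `φ(Gᵢ) = 0` for
some `i`, and the `i`-th tree refutes `φ` by `TreeN.check_sound` run from `[Gᵢ]`. -/
theorem OrbitData.eliminated_of_factoredCheckN (o : OrbitData) (A : ℕ → List ℤ) (n fuel : ℕ) (Gs : List (List ℤ))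
    (Ts : List TreeN) (h : factoredCheckN n fuel o A Gs Ts = true) : o.Eliminated A n := by
  intro k _ _ φ hφ
  simp only [factoredCheckN, Bool.and_eq_true, beq_iff_eq, List.all_eq_true] at h
  obtain ⟨⟨hz, hlen⟩, hall⟩ := h
  -- φ(∏ Gs) = φ(F) = 0
  have hdiff := map_toPoly_eq_zero_of_isZeroModL n φ _ hz
  rw [toPoly_addL, toPoly_smulL, map_add, map_mul, hφ.1, mul_zero, add_zero, toPoly_prodL, map_list_prod,
    List.map_map] at hdiff
  -- some factor is killed
  obtain ⟨G, hG, hG0⟩ : ∃ G ∈ Gs, φ (toPoly G) = 0 := by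
    have h0 : (0 : k) ∈ Gs.map (fun G => φ (toPoly G)) := by
      rw [← List.prod_eq_zero_iff]; exact hdiff
    obtain ⟨G, hG, hG0⟩ := List.mem_map.mp h0
    exact ⟨G, hG, hG0⟩
  -- its tree
  obtain ⟨i, hi, rfl⟩ := List.getElem_of_mem hG
  have hi' : i < Ts.length := hlen ▸ hi
  have hmem : (Gs[i], Ts[i]) ∈ Gs.zip Ts := by
    rw [List.mem_iff_getElem]
    exact ⟨i, by rw [List.length_zip]; exact lt_min hi hi', by rw [List.getElem_zip]⟩
  have hcheck := hall _ hmem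
  exact TreeN.check_sound n fuel Ts[i] o A [Gs[i]] hcheck k φ (by simpa using hG0) hφ.2

/-! ## Toy certificate: `F = x² − 2 ≡ (x − 3)(x + 3) (mod 7)`, entry `c₃ = θ`, TOY allowed traces `{0, 2}`, exponent `7`:
at the factor `x − 3` the realisation has `θ = 3 ∉ {0, 2}`; at `x + 3`, `θ = −3 = 4 ∉ {0, 2}` — each branch closes by a
CONSTANT Bézout identity, e.g. at `x − 3`, `t = 0`: `2(x − 3) − 2x = −6 ≡ 1 (mod 7)`; at `x + 3`, `t = 2`:
`3(x + 3) − 3(x − 2) = 15 ≡ 1 (mod 7)`. -/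

/-- The two linear factors of `x² − 2` modulo `7`. -/
def toyFactors : List (List ℤ) := [[-3, 1], [3, 1]]
/-- One mod-7 tree per factor (leaf cofactors are constants). -/
def toyFactoredTrees : List TreeN :=
  [.split 0 [(0, .leaf [[2], [-2]]), (2, .leaf [[-1], [1]])], .split 0 [(0, .leaf [[5], [-5]]), (2, .leaf [[3], [-3]])]]

/-- The toy factored certificate passes (`F − (x−3)(x+3) = 7 ≡ 0`; four constant Bézout identities). -/
example : factoredCheckN 7 3 toyOrbit toyAllowed toyFactors toyFactoredTrees = true := by decide

/-- Hence the toy orbit data is eliminated for the exponent `7` (factored route). -/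
example : toyOrbit.Eliminated toyAllowed 7 :=
  toyOrbit.eliminated_of_factoredCheckN toyAllowed 7 3 toyFactors toyFactoredTrees (by decide)

end Summit.Ventures.AbcSig
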